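import Summits.ResolutionOfSingularities.ResolutionOfSingularities.Theorems.FrobeniusLadderFInjectiveMacaulayficationFInjectiveMacaulayficationDimFourOfL4
import HarnessLib

/-!
# THE CRUX `FInjectiveMacaulayfication` RESTRICTED TO DIMENSION ≤ 4, in its OWN (reduced) vocabulary, modulo the threefold package and (L4)
# (crux stmt-ResolutionOfSingularities-15315, chain w45a; res-L1-w45a-plan-1 RULINGS R16.64–R16.66 «DIM-4 SLICE»; res-L1-w45a-tri-2 23:20:09Z (b);
# seat res-L1-w45a-stub-3 g7)

[OURS · L1 W4.5a] Support file (`--supports stmt-ResolutionOfSingularities-15315 --as helper`); NOT a statement of any manuscript; def-free;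
CONDITIONAL on the three printed theorems BY NAME (`CossartPiltant2019General` = CP 2019 Thm. 1.1 (i)(ii), `Stacks081R` = Raynaud–Gruson
5.2.2, `CossartPiltant2019Principalization` = CP 2019 Prop. 4.4) and on the chain's CANDIDATE local statement (L4)
`LocalFullificationDimFour.LocalFullificationDimFour` (res-L1-w45a-lead-1, p583849; OURS, conjecture-tagged, consumed as a hypothesis only).
AI-written (AI review is weaker than expert review).

* **`fInjectiveMacaulayfication_dimLe4_of_L4 (hG h081R hP) (hL4)`** — the ∀-text of the route's crux
  `Summit.ResolutionOfSingularities.ResolutionOfSingularities.Theses.FrobeniusLadder.FInjectiveMacaulayfication` VERBATIM with ONE extra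
  binder `topologicalKrullDim X ≤ 4`: every REDUCED separated finite-type `X/k` (`char k = p`) of dimension `≤ 4` has a proper birational
  model whose stalks are domains with Cohen–Macaulay, Frobenius-closed systems of parameters. = res-L1-w45a-lead-1's integral form
  `FInjectiveMacaulayficationDimFourOfL4.fiModel_integral_dimLe4_of_L4` (p584558; THEOREM A(4) of `TerminationModClosedPoints` + F-Temkin at the
  closed points `FTemkinClosedPoints` + CP outright in dimension `≤ 3`) glued over the irreducible components by the door's component gluing
  (`exists_model_of_forall_closeds`, `fiClause_coprod`); the one new input is that a closed subscheme has dimension `≤ dim X`.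
* `exists_fiModel_dimLe4_of_L4` — the same conclusion for a given `X` of dimension `≤ 4`, instance-binder form, for direct use.
[folklore assembly; cite: CossartPiltant2019, Thm. 1.1 (i)(ii); Prop. 4.4; proof of Prop. 4.6 Step 1] [cite: Temkin2008, Prop. 2.3.4]
-/

-- single-problem summit: the doubled namespace component is forced
set_option linter.dupNamespace false

noncomputable section

namespace Summit.ResolutionOfSingularities.ResolutionOfSingularities.Theorems.FInjectiveMacaulayfication.DimLe4Reduced

open CategoryTheory CategoryTheory.Limits AlgebraicGeometry TopologicalSpace IsLocalRing
open Literature.AlgebraicGeometry.Resolution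
open Summit.ResolutionOfSingularities.ResolutionOfSingularities.Theorems.FInjectiveMacaulayfication
open SliceableCentre

/-- A closed subscheme (reduced structure on a closed subset) has topological Krull dimension at most that of the ambient scheme. [folklore] -/
theorem topologicalKrullDim_subscheme_vanishingIdeal_le {X : Scheme.{0}} (Z : Closeds X) :
    topologicalKrullDim (Scheme.IdealSheafData.vanishingIdeal Z).subscheme ≤ topologicalKrullDim X :=
  (Scheme.IdealSheafData.vanishingIdeal Z).subschemeι.isClosedEmbedding.isEmbedding.isInducing.topologicalKrullDim_le

/-- **The crux's conclusion for a given reduced `X` of dimension `≤ 4`** (instance-binder form), modulo the threefold package and (L4).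
[OURS · conditional-result] [cite: CossartPiltant2019, Thm. 1.1 (i)(ii); Prop. 4.4] [cite: Temkin2008, Prop. 2.3.4] -/
theorem exists_fiModel_dimLe4_of_L4
    (hG : CossartPiltant2019General.{0}) (h081R : Stacks081R.{0}) (hP : CossartPiltant2019Principalization.{0})
    (hL4 : LocalFullificationDimFour.LocalFullificationDimFour)
    (p : ℕ) [Fact p.Prime] (k : Type) [Field k] [CharP k p] (X : Scheme.{0}) (f : X ⟶ Spec (.of k))
    [IsSeparated f] [LocallyOfFiniteType f] [QuasiCompact f] [IsReduced X] (h4 : topologicalKrullDim X ≤ 4) :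
    ∃ (X' : Scheme.{0}) (π : X' ⟶ X), IsProper π ∧ IsBirational π ∧ ∀ x : X',
      IsDomain (X'.presheaf.stalk x) ∧ ∀ d : ℕ, ringKrullDim (X'.presheaf.stalk x) = d →
        ∀ s : Fin d → X'.presheaf.stalk x, (Ideal.span (Set.range s)).radical.IsMaximal →
          RingTheory.Sequence.IsWeaklyRegular (X'.presheaf.stalk x) (List.ofFn s) ∧
          ∀ y : X'.presheaf.stalk x, (∃ e : ℕ, y ^ p ^ e ∈ Ideal.span
            ((fun z : X'.presheaf.stalk x => z ^ p ^ e) ''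
              (Ideal.span (Set.range s) : Set (X'.presheaf.stalk x)))) →
            y ∈ Ideal.span (Set.range s) := by
  refine exists_model_of_forall_closeds
    (fun Y : Scheme.{0} => ∀ y : Y, IsDomain (Y.presheaf.stalk y) ∧
      ∀ d : ℕ, ringKrullDim (Y.presheaf.stalk y) = d →
        ∀ s : Fin d → Y.presheaf.stalk y, (Ideal.span (Set.range s)).radical.IsMaximal →
          RingTheory.Sequence.IsWeaklyRegular (Y.presheaf.stalk y) (List.ofFn s) ∧
          ∀ w : Y.presheaf.stalk y, (∃ e : ℕ, w ^ p ^ e ∈ Ideal.span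
            ((fun z : Y.presheaf.stalk y => z ^ p ^ e) ''
              (Ideal.span (Set.range s) : Set (Y.presheaf.stalk y)))) →
            w ∈ Ideal.span (Set.range s))
    (fun Y hY y => (hY.false y).elim) (fun U V hU hV => fiClause_coprod p hU hV) X f fun Z hZ => ?_
  haveI := hZ
  have hdimZ : topologicalKrullDim (Scheme.IdealSheafData.vanishingIdeal Z).subscheme ≤ 4 :=
    (topologicalKrullDim_subscheme_vanishingIdeal_le Z).trans h4
  obtain ⟨X', π, hprop, hbir, -, hfi⟩ :=
    FInjectiveMacaulayficationDimFourOfL4.fiModel_integral_dimLe4_of_L4 hG h081R hP hL4 p k _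
      ((Scheme.IdealSheafData.vanishingIdeal Z).subschemeι ≫ f) hdimZ
  exact ⟨X', π, hprop, hbir, hfi⟩

/-- **★ THE CRUX RESTRICTED TO DIMENSION ≤ 4.** The ∀-text of
`Summit.ResolutionOfSingularities.ResolutionOfSingularities.Theses.FrobeniusLadder.FInjectiveMacaulayfication` VERBATIM with the single extra
binder `topologicalKrullDim X ≤ 4`, modulo {CP 2019 Thm. 1.1, Raynaud–Gruson 5.2.2, CP 2019 Prop. 4.4} BY NAME and the candidate (L4).
[OURS · conditional-result] [cite: CossartPiltant2019, Thm. 1.1 (i)(ii); Prop. 4.4] [cite: Temkin2008, Prop. 2.3.4] -/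
theorem fInjectiveMacaulayfication_dimLe4_of_L4
    (hG : CossartPiltant2019General.{0}) (h081R : Stacks081R.{0}) (hP : CossartPiltant2019Principalization.{0})
    (hL4 : LocalFullificationDimFour.LocalFullificationDimFour) :
    ∀ p : ℕ, p.Prime → ∀ (k : Type) [Field k] [CharP k p] (X : Scheme.{0}) (f : X ⟶ Spec (.of k)),
      IsSeparated f → LocallyOfFiniteType f → QuasiCompact f → IsReduced X → topologicalKrullDim X ≤ 4 →
      ∃ (X' : Scheme.{0}) (π : X' ⟶ X), IsProper π ∧ IsBirational π ∧ ∀ x : X',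
        IsDomain (X'.presheaf.stalk x) ∧ ∀ d : ℕ, ringKrullDim (X'.presheaf.stalk x) = d →
          ∀ s : Fin d → X'.presheaf.stalk x, (Ideal.span (Set.range s)).radical.IsMaximal →
            RingTheory.Sequence.IsWeaklyRegular (X'.presheaf.stalk x) (List.ofFn s) ∧
            ∀ y : X'.presheaf.stalk x, (∃ e : ℕ, y ^ p ^ e ∈ Ideal.span
              ((fun z : X'.presheaf.stalk x => z ^ p ^ e) ''
                (Ideal.span (Set.range s) : Set (X'.presheaf.stalk x)))) →
              y ∈ Ideal.span (Set.range s) := by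
  intro p hp k _ _ X f hsep hft hqc hred h4
  haveI : Fact p.Prime := ⟨hp⟩
  haveI := hsep
  haveI := hft
  haveI := hqc
  haveI := hred
  exact exists_fiModel_dimLe4_of_L4 hG h081R hP hL4 p k X f h4

end Summit.ResolutionOfSingularities.ResolutionOfSingularities.Theorems.FInjectiveMacaulayfication.DimLe4Reduced

end
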